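import Mathlib
import HarnessLib
import HarnessLib.Audit
import Summits.NavierStokesRegularity.Statement
import Literature.Analysis.FluidPDE.ClassicalSolution
import Literature.Analysis.FluidPDE.LerayHopf
import Literature.Analysis.FluidPDE.NSWave0
import Literature.Analysis.FluidPDE.SelfSimilar
import Literature.Analysis.FluidPDE.SelfSimilarLiouville
import Literature.Analysis.FluidPDE.AxisymmetricEuler
import Literature.Analysis.FluidPDE.VectorCalculus
import Summits.NavierStokesRegularity.NavierStokesRegularity.Theorems.AdiabaticEddyClayUniqueness
import HarnessLib.Audit.Status.Attr

/-!
Route: MirrorChamber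

DORMANT since 2026-09-01T11:08:49Z (reconciler: no traction for 5 d (last activity statement-checked at 2026-08-27T10:11:15Z); parked, not closed — `ledger route dormant route-NavierStokesRegularity-MirrorChamber --off` to reactivate) — unstaffed, not closed; items shared with open routes are served there. `ledger route dormant <id> --off` reactivates.

Route MirrorChamber — NavierStokesRegularity (Clay A), NEGATIVE side (target ¬A), realising idea
card mirror-walls-weyl-chamber-equivariant ("The only walls Clay allows are mirrors").

## Thesis X = ChamberBlowup ∧ X5b ("it suffices to show")
ChamberBlowup: for some ν>0 there is a rapidly decaying smooth datum, EQUIVARIANT under the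
hyperoctahedral reflection group B₃ = Õ (the 48 signed permutation matrices g; u(gx) = g u(x)),
whose finite-energy (Leray–Hopf) classical solution of unforced NS on ℝ³×[0,T), T<∞, stays
B₃-equivariant and admits no classical extension past T (X5a of route Blowup,
stmt-NavierStokesRegularity-0152, restricted to the B₃ class).
X5b: Clay-class uniqueness (shared support, stmt-NavierStokesRegularity-0153, attacked in route
Blowup).
Lean (elaborates; planner Sketch.lean rc 0 on the farm):
 ChamberBlowup := ∃ ν>0, ∃ T>0, ∃ u p, IsMaximalSmoothSolution ν 0 u p T ∧ IsLerayHopfOn T ν 0 (u 0)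
u ∧ HasRapidSpatialDecay (u 0) ∧ ∀ t ∈ Ico 0 T, ∀ (σ : Equiv.Perm (Fin 3)) (ε : Fin 3 → ℝ), (∀ i, ε
i = 1 ∨ ε i = -1) → ∀ x, u t (toLp 2 fun i => ε i * x (σ i)) = toLp 2 fun i => ε i * u t x (σ i)

## Dictionary (exact, Elgindi–Jeong arXiv:2001.07840 §1.1)
A B₃-equivariant solution on ℝ³ IS a solution in the Weyl chamber Ũ = {x₁>x₂>x₃>0} (spherical
triangle with angles π/2, π/3, π/4) with PERFECT-SLIP mirror walls (u·n = 0 and ω×n = 0 on each of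
the 9 mirrors, forced by parity). Hence ¬A contains a corner problem for slip-walled cones — the one
setting in which 3-D inviscid singularities are theorems: ElgindiJeong2021 Thm B (Euler blow-up in Ũ
for vorticity C^α up to the walls but not across them, extended to ℝ³ as a bounded vortex patch with
a corner, Rem. 1.6) and ChenHou2025 (wall × symmetry-plane corner). Mirrors are the only walls that
are interior to ℝ³, so this is the only transfer-free import of wall/corner blow-up technology into
Clay (A).

## Assembly X → ¬NavierStokesRegularity
ChamberBlowup → X5b → ¬NavierStokesRegularity: forget the symmetry clause and apply the PROVED glue
Literature.NS.blowup_assembly (stmt-NavierStokesRegularity-0151). Three lines; checked in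
Sketch.lean (theorem assembly_holds).

Rationale: WHY THIS LINE. Every resolved interior-singularity candidate for NS/Euler is mirror-symmetric
(Taylor–Green; Kida1985/BoratavPelz1994/Pelz2001 high-symmetry flow = B₃; Kerr's antiparallel pair =
A₁×A₁), and the only theorem-grade 3-D inviscid singularities use a corner of slip walls
(ElgindiJeong2021 Thms A–B in the B₃ chamber; ChenHou2025 at wall∩mirror). A finite reflection group
does three jobs at once: it manufactures corners without a boundary; it pins and FLATTENS the
would-be singular point (Schur: u = O(|x|³), ω, S = O(|x|²), ∇²p(0) = 0 at the apex for all t —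
support ApexJet), so an apex singularity must be a COLLISION of |W| image structures (Pelz's
dodecapole collapse) and is deeply sub-critical at each fixed time; and it switches off every
catalogued exclusion/depletion channel simultaneously — finite stabiliser
(AxisymmetricTypeIExclusion and continuous-stabiliser counts void), zero helicity, vorticity
direction PRESCRIBED (ω ∥ n) on 9 planes through the apex so Constantin–Fefferman coherence fails
wherever intense vorticity meets two mirrors, and on each mirror stretching of normal vorticity is
literally in-plane mass convergence (support MirrorVorticityLaw). Representation theory also makes
the class the cheapest home of computer-assisted profiles: in the B₃-invariant isotypic component
the linearised Leray operator has no translation/rotation neutral modes and the chamber is 1/48 of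
the volume (card H4; habitat shared with card circulation-relay-machine). Imported areas: finite
reflection groups / representation theory (Schur, isotypic splitting), corner well-posedness and
blow-up à la Elgindi–Jeong, DSS/Liouville technology (ChaeWolf2017RemovingDSS, BradshawTsai2017CPDE,
NecasRuzickaSverak1996, Tsai1998, KNSS2009). No probabilistic/spectral reformulation: symmetry alone
evades no barrier (BARRIERS).
TWO-LAYER PLAN (D-0019). Layer 1 = three RANKED cruxes, all typed, all of NEGATIVE polarity (so a
refutation — a positive theorem in the class — correctly breaks the route):
 #2 ChamberBlowup — X5a in the B₃ class (hardest; the construction half of X).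
 #3 ChamberDssProfile — for some λ>1 a NONTRIVIAL ancient mild solution (ν=1), λ-DSS, with the
Type-I bound |u| ≤ C₀/(|x|+√−t), B₃-equivariant on every slice (= ¬TypeIDSSLiouville λ restricted to
the class; implies Blowup's BlowupTypeIDssProfile stmt-0155 and feeds DssFarFieldSlaving's
truncation bridge stmt-0901; it is also the typed target (R2) named by card
circulation-relay-machine, and the MIRROR-sector sibling of PolyhedralDssProfileExists (stmt-1404,
route QuantisedSymmetry, chiral T/O/I sectors): ChamberDssProfile ⇒ stmt-1404 with G = O ⊂ B₃ ⇒
¬TypeIDSSLiouvilleConjecture, and conversely PolyhedralTypeILiouville (stmt-1405) ⇒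
OctahedralLiouville up to the standard time-shift (Type-I decay ⇒ bounded on (−∞,−δ)) — the two
routes tile the finite-stabiliser habitat, mirror vs chiral).
 #4 ChamberEulerBlowup — finite-time vorticity blow-up for 3-D Euler on ℝ³ from a rapidly decaying
smooth B₃-equivariant datum, admissible (energy ≤ initial) and equivariant on every slice:
ElgindiJeong2021 Thm B one compatibility rung up (𝒞₀ → 𝒞_∞); the inviscid skeleton any Chen–Hou-type
construction of #2 passes through.
Layer 2 (later, glued splits; NOT filed now): #2 ⇐ #3 ∧ (equivariant truncation/stable manifold =
DssFarFieldSlaving's bridge inside the invariant isotypic component); or #2 ⇐ #4 ∧ (viscous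
persistence of a fast equivariant Euler collapse, euler-window cards); #3 ⇐ an equivariant CAP
certificate (CertifiedBlowup's Conditions written in chamber coordinates).
SUPPORT (typed): ClayUniqueness (= stmt-0153 verbatim); ProfileNegatesWall (glue, provable now, 3
lines in Sketch.lean: #3 → ¬TypeIDSSLiouvilleConjecture, so DssFarFieldSlaving's bridge stmt-0901
turns a closed #3 into X5a and, with X5b, into ¬A even before the equivariant truncation exists);
ApexJet (H2, provable now: parity + Schur); MirrorVorticityLaw (H3, provable now: k-th component of
the vorticity equation + parity); OctahedralLiouville (dichotomy partner and kill criterion of #3 —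
proved in Sketch.lean: OctahedralLiouville → ¬ChamberDssProfile; the B₃ analogue of KNSS (L), a new
Liouville target strictly between the known axisymmetric cases and (L)).
KILL CRITERIA. NoBlowup (stmt-0054), or regularity of the B₃ class, ⇒ close refuted:ChamberBlowup.
OctahedralLiouville / TypeIDSSLiouvilleConjecture / its B₃ restriction proved ⇒ #3 refuted: restate
the profile step of #2 as Type II or off-apex (W-orbits of ≥ 6 points carry residual A₁×A₁ = Kerr
symmetry only) or close with census. #4 refuted is out of reach (global smooth B₃ Euler);
numerically, resolved B₃ runs (NS from mollified Elgindi–Jeong data; Kida–Pelz data) showing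
Re-saturating ‖ω‖∞ growth by sheet formation (already seen by Boratav–Pelz, Hou–Li 2008,
Grafke–Homann–Dreher–Grauer 2008) weaken the line without deciding it.
NOT DECOMPOSED / NOT FILED. (H1*) of the card ("NS from the Elgindi–Jeong 𝒞₀ datum is global for
every ν"): not typed (EJ data class) and on inspection NOT perturbative — EJ's driver is
0-homogeneous vorticity at the apex (ω₀(0) ≠ 0 in the closed chamber), ‖ω(t)‖∞ grows at every scale
at once and scales r ≫ √(νT*) are driven inviscidly by outer shells (inner shells contribute
O((ρ/r)³)); viscosity owns only r ≲ √(νT*), so for small ν it is Clay-hard in the class; kept on the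
card as a numerical test. Also left out: the compatibility ladder 𝒞_k, W-orbit bookkeeping of
off-apex singular points, the equivariant CAP objects, X5b (route Blowup's business).
NUMBERS. |B₃| = 48, 9 mirrors, 13 axes; chamber angles π/2, π/3, π/4; apex jet: u vanishes to order
3, p − p(0) to order 4; items at open 10 = target + assembly + 3 cruxes + 5 support; Sketch.lean rc
0 with 4 sanity theorems (assembly_holds, octahedralLiouville_kills_profile, profile_refutes_wall,
profileNegatesWall_holds).

Novelty: NOVELTY (searched 2026-08-15, this pass: `lit frontier NavierStokesRegularity --since 2022` (30 rows
— forward self-similar/DSS, non-uniqueness, ε-regularity; nothing equivariant or finite-group), `lit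
read arXiv:2001.07840 --pages 1-8` (Elgindi–Jeong: Õ = 48 signed permutations §1.1; Thm A LWP and
Thm B finite-time blow-up in Ũ for C^α∩C̊^α vorticity non-vanishing at 0; Rem. 1.6 extension to ℝ³
as a singular vortex patch; Euler only — no viscosity, no smooth-across-mirror data, no Liouville),
crossref "Pelz symmetry hydrodynamic blow-up octahedral" (Pelz2001 = doi:10.1017/s0022112001005298;
Pelz 2003 doi:10.1016/s0169-5983(03)00039-x extended-series evidence for blow-up of the full
octahedral flow; Pelz–Boratav doi:10.1007/bfb0102396), crossref "octahedral symmetry incompressible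
Euler Navier-Stokes singularity" (only doi:10.1016/j.aim.2021.108091 = ElgindiJeong2021 and
Ohkitani–Gibbon doi:10.1063/1.1321256, a different class), crossref "Kida Pelz high symmetry …
singularity" (Moffatt–Kimura doi:10.1017/jfm.2019.263, pyramid reconnection — different object),
galaxy pdf substring "octahedral symmetry group"/"high-symmetry flow singularity" (0 relevant);
zbMATH 0 hits; arXiv/S2/OpenAlex rate-limited (429) and local searchd unavailable (rc 75) during
this pass — plus the card's audit (refuter-novelty-audit-8, 2026-08-15: zbMATH
octahedral/Pelz/Kida/Boratav–Pelz sweeps, arXiv:1610.09701, arXiv:1708.09372). In-tree neighbours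
read: route QuantisedSymmetry (opened today: the CHIRA  [refs: 10.1017/s0022112001005298, 10.1016/s0169-5983(03, 10.1007/bfb0102396, 10.1016/j.aim.2021.108091, 10.1063/1.1321256, 10.1017/jfm.2019.263, 2001.07840, 1610.09701, 1708.09372, doi:10.1017/s0022112001005298, doi:10.1016/s0169-5983, doi:10.1007/bfb0102396, doi:10.1016/j.aim.2021.108091, doi:10.1063/1.1321256, doi:10.1017/jfm.2019.263, Pelz2001, ElgindiJeong2021, BoratavPelz1994, Kida1985, KNSS2009]

Barriers (technique_class: blowup-construction type-I-blowup-rate reflection-group): BARRIERS (catalogue Literature/Barriers/NavierStokesRegularity read: 13 head files; technique_class: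
blowup-construction type-I-blowup-rate reflection-group).
- Literature.Barriers.NavierStokesRegularity.AxisymmetricTypeIExclusion: NOT applicable, by design —
B₃-equivariant fields have a FINITE stabiliser and no axis, while SereginSverak2009 Thm 3.1 (=
Literature.Analysis.FluidPDE.knss_no_axisymmetric_typeI) needs axisymmetry on every slice; off-apex
singular W-orbits keep only A₁ or A₁×A₁ (mirror) symmetry, not axisymmetry either. So Leray-rate
(Type-I) profiles are not excluded in the class: this is exactly why the class is the residual
habitat of crux ChamberDssProfile.
- Literature.Barriers.NavierStokesRegularity.LeraySelfSimilarBlowupExclusion: applies inside the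
class (necas_ruzicka_sverak, tsai_selfsimilar, tsai_selfsimilar_local_energy use no symmetry): an
EXACTLY backward self-similar equivariant profile in L³/L^q or with local energy bounds is zero;
ChamberDssProfile asks for DISCRETE self-similarity with λ away from 1 (ChaeWolf2017RemovingDSS Thm
1.3 removes λ near 1 under the same Type-I bound) — the same bet as Blowup's crux 0155, now with the
neutral translation/rotation modes stripped by symmetry.
- Literature.Barriers.NavierStokesRegularity.CriticalNormBlowupNecessity: applies to ChamberBlowup
(ess_endpoint, seregin_L3_blowup, tao_L3_blowup_rate): ‖u(t)‖_{L³} must diverge at T in the chamber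
too; consistent — a Type-I DSS profile is weak-L³ only and nothing in

History (route lifecycle, newest last):
- 2026-08-15T16:14:14Z · rev 4: dropped ProfileNegatesWall — route-repair (staffability): drop support ProfileNegatesWall (stmt-1603) — not load-bearing: the deciding theorem closes uses only ChamberBlowup + ClayUniquenes (planner-rbadge-NavierStokesRegularity-MirrorCh-de5cbd29-g2-0)
- 2026-08-22T20:38:52Z · DORMANT — reconciler: no traction for 5.6 d (last activity statement-grounded at 2026-08-17T04:34:57Z); parked, not closed — `ledger route dormant route-NavierStokesRegul (operator:999:3108161)
- 2026-08-27T04:05:23Z · REACTIVATED — reconciler: reactivated — activity item-proof-filed at 2026-08-27T02:46:13Z after parking at 2026-08-22T20:38:52Z (operator:999:1429967)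
- 2026-09-01T11:08:49Z · DORMANT — reconciler: no traction for 5 d (last activity statement-checked at 2026-08-27T10:11:15Z); parked, not closed — `ledger route dormant route-NavierStokesRegulari (operator:999:2596060)

sub-problem: NavierStokesRegularity · status: dormant · opened planner-plancard-NavierStokesRegularity-Navie-78d8ddca-0 2026-08-15T10:57:38Z · rev 6 · ledger route-NavierStokesRegularity-MirrorChamber
GENERATED by the gate from the ledger (D-0016/17). Provers cite these decls: `theorem foo : Summit.NavierStokesRegularity.NavierStokesRegularity.Theses.MirrorChamber.<Decl> := …` in Summits/NavierStokesRegularity/NavierStokesRegularity/Theorems/<Name>.lean.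
-/

namespace Summit.NavierStokesRegularity.NavierStokesRegularity.Theses.MirrorChamber

open scoped BigOperators Topology Manifold Classical MeasureTheory ProbabilityTheory Matrix InnerProductSpace ComplexConjugate ContinuousMap
open Filter Set Function TopologicalSpace MeasureTheory

attribute [summit_statement] _root_.NavierStokesRegularity

open Literature.NS

/-- item stmt-NavierStokesRegularity-1596 · target · rank 0 · open · by planner
why it might fail: ChamberBlowup may be false (B₃ class regular: BoratavPelz1994/Pelz2001 viscous saturation; NoBlowup 0054); X5b open as typed — class (A) has bounded energy, no energy inequality, so weak–strong uniqueness vs Leray–Hopf is not automatic (Tao2011 = arXiv:1108.1165 uses H¹/normalised-pressure classes).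
sources: Pelz2001, BoratavPelz1994, ElgindiJeong2021, Tao2011, Fefferman2000
[target] X = ChamberBlowup ∧ X5b: finite-time loss of smoothness of a finite-energy (Leray–Hopf)
classical NS solution from a rapidly decaying B₃-equivariant datum (the solution B₃-equivariant on
every slice), AND Clay-class uniqueness (stmt-NavierStokesRegularity-0153, shared with route
Blowup). [sources: Pelz2001, ElgindiJeong2021, Fefferman2000, Tao2011] -/
@[route_item "route-NavierStokesRegularity-MirrorChamber"]
def Thesis : Prop :=
  (∃ ν : ℝ, 0 < ν ∧ ∃ T : ℝ, 0 < T ∧ ∃ (u : ℝ → EuclideanSpace ℝ (Fin 3) → EuclideanSpace ℝ (Fin 3)) (p : ℝ → EuclideanSpace ℝ (Fin 3) → ℝ), Literature.Analysis.FluidPDE.IsMaximalSmoothSolution ν 0 u p T ∧ Literature.Analysis.FluidPDE.IsLerayHopfOn T ν 0 (u 0) u ∧ Literature.Analysis.FluidPDE.HasRapidSpatialDecay (u 0) ∧ ∀ t ∈ Set.Ico 0 T, ∀ (σ : Equiv.Perm (Fin 3)) (ε : Fin 3 → ℝ), (∀ i, ε i = 1 ∨ ε i = -1) → ∀ x : EuclideanSpace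 ℝ (Fin 3), u t (WithLp.toLp 2 fun i => ε i * x (σ i)) = WithLp.toLp 2 fun i => ε i * u t x (σ i)) ∧ (∀ ν : ℝ, 0 < ν → ∀ (u₀ : EuclideanSpace ℝ (Fin 3) → EuclideanSpace ℝ (Fin 3)), Literature.Analysis.FluidPDE.HasRapidSpatialDecay u₀ → ∀ (u v : ℝ → EuclideanSpace ℝ (Fin 3) → EuclideanSpace ℝ (Fin 3)) (p q : ℝ → EuclideanSpace ℝ (Fin 3) → ℝ) (T : ℝ), 0 < T → Literature.Analysis.FluidPDE.IsSmoothOnHalfSpace u → Literature.Analysis.FluidPDE.IsSmoothOnHalfSpace p → Literature.Analysis.FluidPDE.IsNavierStokesSolution ν 0 u₀ u p → Literature.Analysis.FluidPDE.HasBoundedEnergy u → Literature.Analysis.FluidPDE.IsClassicalNSSolutionOn (Set.Ico 0 T) ν 0 v q → Literature.Analysis.FluidPDE.IsLerayHopfOn T ν 0 u₀ v → v 0 = u₀ → ∀ t ∈ Set.Ico 0 T, u t = v t)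

/-- item stmt-NavierStokesRegularity-1597 · crux · rank 2 · open · by planner
why it might fail: The B₃ class may be globally regular (NoBlowup 0054 refutes it): resolved Kida–Pelz NS/Euler runs grow then deplete into sheets (BoratavPelz1994, Pelz2001, HouLi2008, GrafkeEtAl2008); the apex is flat (u=O(|x|³)); a Type-I apex profile faces max-principle-free Liouville methods (PineauVicol2026).
sources: Pelz2001, BoratavPelz1994, Kida1985, HouLi2008, GrafkeEtAl2008, ElgindiJeong2021
[crux] X5a (shape of stmt-NavierStokesRegularity-0152) INSIDE the hyperoctahedral class: ∃ ν>0, T>0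
and a classical NS solution on ℝ³×[0,T), Leray–Hopf from a rapidly decaying datum, B₃-equivariant
(u(t,gx) = g u(t,x) for the 48 signed permutation matrices g = (σ, ε)) on every slice t<T, admitting
no classical extension past T. Dictionary (ElgindiJeong2021 §1.1): = blow-up in the Weyl chamber
{x₁>x₂>x₃>0} with perfect-slip mirror walls, interior to ℝ³. The apex is permanently flat (ApexJet),
so an apex singularity is a COLLISION of |W| image structures (Pelz's dodecapole collapse,
Pelz2001); every catalogued depletion/exclusion channel is off at once (finite stabiliser, zero
helicity, ω ∥ n prescribed on 9 planes); an equivariant computer-assisted profile lives in 1/48 of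
the volume with the translation/rotation neutral modes absent from the invariant isotypic component.
Trivially implies Blowup's BlowupExists (0152). Why it might fail: the class may be regular
(numerics saturate); if OctahedralLiouville holds an apex singularity must be Type II. [sources:
Pelz2001, BoratavPelz1994, Kida1985, ElgindiJeong2021, Hou2022PotentiallySingularNS, ChenHou2025,
doi:10.1016/s0169-5983(03)000 -/
@[route_item "route-NavierStokesRegularity-MirrorChamber", crux]
def ChamberBlowup : Prop :=
  ∃ ν : ℝ, 0 < ν ∧ ∃ T : ℝ, 0 < T ∧ ∃ (u : ℝ → EuclideanSpace ℝ (Fin 3) → EuclideanSpace ℝ (Fin 3)) (p : ℝ → EuclideanSpace ℝ (Fin 3) → ℝ), Literature.Analysis.FluidPDE.IsMaximalSmoothSolution ν 0 u p T ∧ Literature.Analysis.FluidPDE.IsLerayHopfOn T ν 0 (u 0) u ∧ Literature.Analysis.FluidPDE.HasRapidSpatialDecay (u 0) ∧ ∀ t ∈ Set.Ico 0 T, ∀ (σ : Equiv.Perm (Fin 3)) (ε : Fin 3 → ℝ), (∀ i, ε i = 1 ∨ ε i = -1) → ∀ x : EuclideanSpace ℝ (Fin 3), u t (WithLp.toLp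 2 fun i => ε i * x (σ i)) = WithLp.toLp 2 fun i => ε i * u t x (σ i)

/-- item stmt-NavierStokesRegularity-1598 · crux · rank 3 · open · by planner
why it might fail: Type-I DSS Liouville (BradshawTsai2017CPDE OP 5.1, Tsai2018 Conj 8.8) may hold: 1<λ<λ*(C₀) is trivial (ChaeWolf2017RemovingDSS Thm 1.3), now by a quantitative weighted-L² method, no head-pressure maximum principle (PineauVicol2026 Thm 1.6–1.7); SS profiles vanish (NecasRuzickaSverak1996, Tsai1998).
sources: ChaeWolf2017RemovingDSS, PineauVicol2026, BradshawTsai2017CPDE, Tsai2018, NecasRuzickaSverak1996, Tsai1998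
[crux] Profile half of #2 and the typed form of the card's equivariant-economy bet (H4): for some
λ>1 there is a NONTRIVIAL ancient mild solution (ν=1) on ℝ³×(−∞,0) with measurable slices, λ-DSS
(λu(λ²t,λx) = u(t,x)), Type-I bound |u| ≤ C₀/(|x|+√−t), B₃-equivariant on every slice t<0. Literally
a counterexample to Literature.Analysis.FluidPDE.TypeIDSSLiouville λ inside the class: implies
Blowup's BlowupTypeIDssProfile (stmt-0155; Sketch theorem profile_refutes_wall) and feeds
DssFarFieldSlaving's truncation bridge (stmt-0901); it is the typed target (R2) also proposed by
card circulation-relay-machine, and the MIRROR-sector sibling of QuantisedSymmetry's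
PolyhedralDssProfileExists (stmt-1404, chiral T/O/I): ChamberDssProfile ⇒ stmt-1404 with G = O ⊂ B₃.
Why the class: in the B₃-invariant isotypic component the linearised Leray operator in similarity
variables has no translation/rotation neutral modes (they transform under T₁u/T₁g), leaving scaling
— the cleanest spectral problem for a DSS fixed point and 1/48 of the volume for a certified
computation; Type-I DSS is NOT excluded here (AxisymmetricTypeIExclusion needs an axis). Refuted by
OctahedralLiouville (Sketch theorem octahedra -/
@[route_item "route-NavierStokesRegularity-MirrorChamber"]
def ChamberDssProfile : Prop :=
  ∃ c : ℝ, 1 < c ∧ ∃ u : ℝ → EuclideanSpace ℝ (Fin 3) → EuclideanSpace ℝ (Fin 3), Literature.Analysis.FluidPDE.IsAncientMildSolution 1 u ∧ (∀ t < 0, AEStronglyMeasurable (u t) volume) ∧ Literature.Analysis.FluidPDE.IsDiscretelySelfSimilar c u ∧ (∃ C₀ : ℝ, Literature.Analysis.FluidPDE.HasTypeIDecay C₀ u) ∧ (∀ t < 0, ∀ (σ : Equiv.Perm (Fin 3)) (ε : Fin 3 → ℝ), (∀ i, ε i = 1 ∨ ε i = -1) → ∀ x : EuclideanSpace ℝ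 (Fin 3), u t (WithLp.toLp 2 fun i => ε i * x (σ i)) = WithLp.toLp 2 fun i => ε i * u t x (σ i)) ∧ ¬ (∀ t < 0, u t =ᵐ[volume] 0)

/-- item stmt-NavierStokesRegularity-17624 · crux · rank 3 · open · by planner
why it might fail: No backward-DSS ⇒ finite-energy realisation is known: the orbit's monodromy may be non-hyperbolic even in the invariant isotypic component (GallayWayne2002 App. A half-plane spectrum; P_σ unbounded on Gaussian L²); nonlocal pressure may destroy an unstable apex collapse under any far-field cut-off.
sources: JiaSverak2015, JiaSverak2014, BradshawTsai2017CPDE, ChaeWolf2017RemovingDSS, GallayWayne2002, KNSS2009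
[crux] X₂ of the crux-strategist split of the deciding crux ChamberBlowup (BC2 redirect 2026-08-17;
X₁ = ChamberDssProfile, glue chamberBlowup_of_profile_truncation PROVED in
Cruxes/ChamberBlowup/Split.lean, rc0/0 sorry). EQUIVARIANT TRUNCATION = far-field slaving of the
apex profile, the route's declared layer-2 seam '#2 ⇐ #3 ∧ equivariant truncation': for EVERY
witness of ChamberDssProfile (c>1; U ancient mild, ν=1, measurable slices, c-DSS, Type-I |U| ≤
C₀/(|x|+√−t), B₃-equivariant on every slice t<0, not a.e. zero) there are T>0 and a classical NS
solution (u,p), ν=1, f=0, on ℝ³×[0,T), Leray–Hopf on [0,T) from its own RAPIDLY DECAYING datum u 0,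
B₃-equivariant on every slice, BOUNDED on a far field {|x| ≥ R}×[0,T), whose velocity is UNBOUNDED
on [0,T)×ℝ³. Stated in the construction's output form (sup-norm blow-up confined to a ball); the
glue upgrades it to IsMaximalSmoothSolution by compactness of [0,T]×closedBall R + continuity of a
would-be extension (≈30 lines, not a one-line seam). WHY EASIER THAN ChamberBlowup: perturbative
around a GIVEN exact singular object — finite-codimension stability of the profile's 2log c-periodic
similarity orbit in the B₃-INVARIANT isotypic com -/
@[route_item "route-NavierStokesRegularity-MirrorChamber"]
def EquivariantTruncation : Prop :=
  ∀ (c : ℝ) (U : ℝ → EuclideanSpace ℝ (Fin 3) → EuclideanSpace ℝ (Fin 3)), 1 < c → Literature.Analysis.FluidPDE.IsAncientMildSolution 1 U → (∀ t < 0, AEStronglyMeasurable (U t) volume) → Literature.Analysis.FluidPDE.IsDiscretelySelfSimilar c U → (∃ C₀ : ℝ, Literature.Analysis.FluidPDE.HasTypeIDecay C₀ U) → (∀ t < 0, ∀ (σ : Equiv.Perm (Fin 3)) (ε : Fin 3 → ℝ), (∀ i, ε i = 1 ∨ ε i = -1) → ∀ x : EuclideanSpace ℝ (Fin 3), U t (WithLp.toLp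 2 fun i => ε i * x (σ i)) = WithLp.toLp 2 fun i => ε i * U t x (σ i)) → ¬ (∀ t < 0, U t =ᵐ[volume] 0) → ∃ T : ℝ, 0 < T ∧ ∃ (u : ℝ → EuclideanSpace ℝ (Fin 3) → EuclideanSpace ℝ (Fin 3)) (p : ℝ → EuclideanSpace ℝ (Fin 3) → ℝ), Literature.Analysis.FluidPDE.IsClassicalNSSolutionOn (Set.Ico 0 T) 1 0 u p ∧ Literature.Analysis.FluidPDE.IsLerayHopfOn T 1 0 (u 0) u ∧ Literature.Analysis.FluidPDE.HasRapidSpatialDecay (u 0) ∧ (∀ t ∈ Set.Ico 0 T, ∀ (σ : Equiv.Perm (Fin 3)) (ε : Fin 3 → ℝ), (∀ i, ε i = 1 ∨ ε i = -1) → ∀ x : EuclideanSpace ℝ (Fin 3), u t (WithLp.toLp 2 fun i => ε i * x (σ i)) = WithLp.toLp 2 fun i => ε i * u t x (σ i)) ∧ (∃ R M : ℝ, ∀ t ∈ Set.Ico 0 T, ∀ x : EuclideanSpace ℝ (Fin 3), R ≤ ‖x‖ → ‖u t x‖ ≤ M) ∧ (∀ M : ℝ, ∃ t ∈ Set.Ico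 0 T, ∃ x : EuclideanSpace ℝ (Fin 3), M < ‖u t x‖)

/-- item stmt-NavierStokesRegularity-1599 · crux · rank 4 · open · by planner
why it might fail: Smooth finite-energy Euler blow-up on ℝ³ with no wall is open in every class: proofs need C^{1,α} velocity (Elgindi2021AnnMath, CordobaMartinezzoroaZheng2023, arXiv:2603.10945) or a wall (ChenHou2025); EJ2021 Thm B driver ω₀(0)≠0 dies for smooth data (flat apex); Kida–Pelz runs deplete (HouLi2008).
sources: ElgindiJeong2021, Elgindi2021AnnMath, CordobaMartinezzoroaZheng2023, ChenHou2025, HouLi2008, GrafkeEtAl2008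
[crux] Inviscid skeleton: a classical 3-D EULER solution (IsClassicalNSSolutionOn with ν = 0, f = 0)
on ℝ³×[0,T) from a rapidly decaying smooth datum, admissible (eEnergy (u t) ≤ eEnergy (u 0), which
with weak–strong uniqueness pins the witness to the physical solution and kills the potential-flow
parasites a(t)∇h) and B₃-equivariant on every slice, whose vorticity blows up at T
(Literature.Analysis.FluidPDE.VorticityBlowsUpAt; BealeKatoMajda1984). ElgindiJeong2021
(arXiv:2001.07840 Thm B + Rem. 1.6) prove exactly this one compatibility rung lower: vorticity C^α
up to the chamber walls but not across them (𝒞₀ = bounded vortex patch with a corner at the apex,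
ω₀(0) ≠ 0 driving a scale-invariant collapse; blow-up iff conditions on ω₀(0)). For SMOOTH
equivariant data ApexJet forces ω = O(|x|²) at the apex, so the EJ driver is absent and a smooth
blow-up must be a collapse INTO the apex (Pelz) or onto a lower-symmetry W-orbit — the open interior
smooth-data Euler problem, posed in the class where every numerical candidate lives (Kida–Pelz, Kerr
= A₁×A₁, Taylor–Green). Any Chen–Hou-type viscous construction of #2 passes through it; by itself it
does not bear on (A). [sources: ElgindiJeo -/
@[route_item "route-NavierStokesRegularity-MirrorChamber"]
def ChamberEulerBlowup : Prop :=
  ∃ T : ℝ, 0 < T ∧ ∃ (u : ℝ → EuclideanSpace ℝ (Fin 3) → EuclideanSpace ℝ (Fin 3)) (p : ℝ → EuclideanSpace ℝ (Fin 3) → ℝ), Literature.Analysis.FluidPDE.IsClassicalNSSolutionOn (Set.Ico 0 T) 0 0 u p ∧ Literature.Analysis.FluidPDE.HasRapidSpatialDecay (u 0) ∧ (∀ t ∈ Set.Ico 0 T, Literature.Analysis.FluidPDE.eEnergy (u t) ≤ Literature.Analysis.FluidPDE.eEnergy (u 0) ∧ ∀ (σ : Equiv.Perm (Fin 3)) (ε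 : Fin 3 → ℝ), (∀ i, ε i = 1 ∨ ε i = -1) → ∀ x : EuclideanSpace ℝ (Fin 3), u t (WithLp.toLp 2 fun i => ε i * x (σ i)) = WithLp.toLp 2 fun i => ε i * u t x (σ i)) ∧ Literature.Analysis.FluidPDE.VorticityBlowsUpAt u T

/-- item stmt-NavierStokesRegularity-0153 · support · rank 9 · closed · proved by Summit.NavierStokesRegularity.NavierStokesRegularity.Theorems.adiabaticEddy_clayUniqueness_proof @ bd26efe366a2 (prover) · by planner
sources: Fefferman2000, Tao2011
Fefferman's class (A) = jointly C^∞ on ℝ³×[0,∞) + sup_t ∫|u|² < ∞; no energy inequality, no decay of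
∇u, no integrability in LPS scales is assumed. Claim: such (u,p) coincides on [0,T) with any
Leray–Hopf classical solution v from the same rapidly decaying datum. Expected route: smoothness +
bounded energy ⇒ u is a distributional solution with locally finite dissipation?? (NOT automatic:
∫∫|∇u|² may be infinite) — this is exactly the delicate point; alternatives: Liouville-type control
of the pressure (p harmonic part must be affine ⇒ excluded by bounded energy), then local energy
inequality, then weak–strong uniqueness (Prodi 1959, Serrin 1963) against v which is in every LPS
class on compacts of [0,T). [sources: Prodi1959, Serrin1963, Fefferman2000, LemarieRieusset2002,
RobinsonRodrigoSadowski2016] -/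
@[route_item "route-NavierStokesRegularity-MirrorChamber", crux]
def ClayUniqueness : Prop :=
  ∀ ν : ℝ, 0 < ν → ∀ (u₀ : EuclideanSpace ℝ (Fin 3) → EuclideanSpace ℝ (Fin 3)), Literature.Analysis.FluidPDE.HasRapidSpatialDecay u₀ → ∀ (u v : ℝ → EuclideanSpace ℝ (Fin 3) → EuclideanSpace ℝ (Fin 3)) (p q : ℝ → EuclideanSpace ℝ (Fin 3) → ℝ) (T : ℝ), 0 < T → Literature.Analysis.FluidPDE.IsSmoothOnHalfSpace u → Literature.Analysis.FluidPDE.IsSmoothOnHalfSpace p → Literature.Analysis.FluidPDE.IsNavierStokesSolution ν 0 u₀ u p → Literature.Analysis.FluidPDE.HasBoundedEnergy u → Literature.Analysis.FluidPDE.IsClassicalNSSolutionOn (Set.Ico 0 T) ν 0 v q → Literature.Analysis.FluidPDE.IsLerayHopfOn T ν 0 u₀ v → v 0 = u₀ → ∀ t ∈ Set.Ico 0 T, u t = v t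

/-- `ClayUniqueness` holds: proved by `Summit.NavierStokesRegularity.NavierStokesRegularity.Theorems.adiabaticEddy_clayUniqueness_proof` @ bd26efe366a2. -/
theorem ClayUniqueness_holds : ClayUniqueness := _root_.Summit.NavierStokesRegularity.NavierStokesRegularity.Theorems.adiabaticEddy_clayUniqueness_proof

/-- item stmt-NavierStokesRegularity-1600 · support · rank 9 · closed · proved by Summit.NavierStokesRegularity.NavierStokesRegularity.Theorems.mirrorChamber_apexJet_proof (prover) · by planner
sources: BoratavPelz1994, Pelz2001, ElgindiJeong2021
[support] (H2) The apex jet is flat — provable NOW (parity + Schur): for v : ℝ³ → ℝ³ of class C²,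
divergence free and B₃-equivariant, v 0 = 0 (−I ∈ B₃ makes v odd), fderiv v 0 = 0 (Dv(0) commutes
with all 48 signed permutation matrices: with the diagonal sign matrices ⇒ diagonal, with
permutations ⇒ scalar cI; trace = div = 0 ⇒ c = 0) and iteratedFDeriv 2 v 0 = 0 (second derivative
of an odd map is odd). Consequences used by the line (not part of the statement): u = O(|x|³), ω and
S = O(|x|²) at the apex for all t, Δp(0) = ½|ω|²−|S|² = 0 and ∇²p(0) = (Δp/3)I = 0 — a permanently
flat critical point of velocity and pressure, deeply sub-critical at each fixed time, so an apex
singularity is a collision; numerically Boratav–Pelz's 'locally isotropic pressure Hessian' at the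
symmetry centre. [sources: BoratavPelz1994, Pelz2001, ElgindiJeong2021 §1.1] -/
@[route_item "route-NavierStokesRegularity-MirrorChamber"]
def ApexJet : Prop :=
  ∀ v : EuclideanSpace ℝ (Fin 3) → EuclideanSpace ℝ (Fin 3), ContDiff ℝ 2 v → Literature.Analysis.FluidPDE.VectorCalculus.IsDivFree v → (∀ (σ : Equiv.Perm (Fin 3)) (ε : Fin 3 → ℝ), (∀ i, ε i = 1 ∨ ε i = -1) → ∀ x : EuclideanSpace ℝ (Fin 3), v (WithLp.toLp 2 fun i => ε i * x (σ i)) = WithLp.toLp 2 fun i => ε i * v x (σ i)) → v 0 = 0 ∧ fderiv ℝ v 0 = 0 ∧ iteratedFDeriv ℝ 2 v 0 = 0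

-- `ApexJet` holds: proved by `Summit.NavierStokesRegularity.NavierStokesRegularity.Theorems.mirrorChamber_apexJet_proof` (its module imports this route file, so no `_holds` link can be stated here).

/-- item stmt-NavierStokesRegularity-1601 · support · rank 9 · closed · proved by Summit.NavierStokesRegularity.NavierStokesRegularity.Theorems.mirrorChamber_mirrorVorticityLaw_proof (prover) · by planner
sources: Kida1985, BoratavPelz1994, BealeKatoMajda1984, ConstantinFefferman1993
[support] (H3) Mirror law — provable NOW (a computation): for a classical solution of NS (any ν,
also ν = 0; f = 0) on [0,T) that is equivariant at every t under ONE reflection x_k ↦ −x_k, at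
interior times t ∈ (0,T) and points of the mirror {x_k = 0}: (i) the tangential vorticity vanishes,
ω ∥ e_k (parity: tangential u even, normal u odd across the mirror); (ii) ∂_t ω_k + u·∇ω_k − ω_k ∂_k
u_k = ν Δω_k — the k-th component of the vorticity equation ∂_tω + (u·∇)ω = (ω·∇)u + νΔω with (i)
inserted. Since u_k = 0 and ∂_k u_k = −div_P u_P on the mirror, (ii) is the CONSERVATIVE law ∂_t ω_k
+ div_P(u_P ω_k) = ν Δω_k: stretching of normal vorticity IS in-plane convergence, a signed-mass
concentration problem on each of the 9 mirrors of B₃ (the dividing-plane identity of the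
reconnection literature, one mirror at a time). Proof needs: curl of the momentum equation for
jointly C^∞ (u,p) (symmetry of mixed partials; cf. named fact
Literature.Analysis.FluidPDE.isVorticitySolutionOn_iff), curl(∇p) = 0, curl Δ = Δ curl, div u = 0.
[sources: Kida1985, BoratavPelz1994, BealeKatoMajda1984 §1 (vorticity equation),
ConstantinFefferman1993] -/
@[route_item "route-NavierStokesRegularity-MirrorChamber"]
def MirrorVorticityLaw : Prop :=
  ∀ (ν T : ℝ) (u : ℝ → EuclideanSpace ℝ (Fin 3) → EuclideanSpace ℝ (Fin 3)) (p : ℝ → EuclideanSpace ℝ (Fin 3) → ℝ) (k : Fin 3), Literature.Analysis.FluidPDE.IsClassicalNSSolutionOn (Set.Ico 0 T) ν 0 u p → (∀ t ∈ Set.Ico 0 T, ∀ x : EuclideanSpace ℝ (Fin 3), u t (WithLp.toLp 2 fun i => if i = k then -x i else x i) = WithLp.toLp 2 fun i => if i = k then -(u t x i) else u t x i) → ∀ t ∈ Set.Ioo 0 T, ∀ x : EuclideanSpace ℝ (Fin 3), x k = 0 → (∀ i, i ≠ k → Literature.Analysis.FluidPDE.curl (u t) x i = 0) ∧ deriv (fun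 s => Literature.Analysis.FluidPDE.curl (u s) x k) t + fderiv ℝ (fun y => Literature.Analysis.FluidPDE.curl (u t) y k) x (u t x) - Literature.Analysis.FluidPDE.curl (u t) x k * fderiv ℝ (fun y => u t y k) x (EuclideanSpace.single k 1) = ν * Laplacian.laplacian (fun y => Literature.Analysis.FluidPDE.curl (u t) y k) x

-- `MirrorVorticityLaw` holds: proved by `Summit.NavierStokesRegularity.NavierStokesRegularity.Theorems.mirrorChamber_mirrorVorticityLaw_proof` (its module imports this route file, so no `_holds` link can be stated here).

/-- item stmt-NavierStokesRegularity-1602 · support · rank 9 · open · by planner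
why it might fail: May be FALSE: a nontrivial B₃-equivariant Type-I ancient solution (e.g. the DSS profile of crux #3, Pelz-type collapse) would refute it; and no engine beyond parity/apex structure is known — (L) is open even for bounded steady flows (KNSS2009 §1).
sources: KNSS2009, SereginSverak2009, AlbrittonBarker2019, ChaeWolf2017RemovingDSS, arXiv:math/0604550
[support] Dichotomy partner and KILL CRITERION of crux ChamberDssProfile (Sketch theorem:
OctahedralLiouville → ¬ChamberDssProfile): every ancient mild solution (ν = 1) on ℝ³×(−∞,0) with
measurable slices, B₃-equivariant on every slice, with the Type-I bound |u| ≤ C₀/(|x|+√−t), vanishes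
(a.e. on every slice). The symmetric-class analogue of KNSS (L): weaker than (L)/(L′) (fewer
candidates), stronger than the B₃-restricted TypeIDSSLiouville; every known case of (L) runs on a
scalar maximum principle supplied by a CONTINUOUS symmetry (KNSS2009 Thms 5.1–5.3;
knss_axisymmetric_no_swirl, knss_bound_C_over_r), absent here — the available structure is the flat
apex (ApexJet), ω ∥ n on 9 planes and the nine conservative mirror laws (MirrorVorticityLaw), each
mirror density an ancient solution of a 2-D drift–diffusion with Type-I drift. Consistency checks
passed: (−1)-homogeneous steady candidates are Landau solutions (Šverák arXiv:math/0604550),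
axisymmetric hence zero if B₃-equivariant; a steady equivariant flow with |u| ≤ C/|x| is a
D-solution in L^{9/2}, hence zero (Galdi). A proof excludes Type-I APEX blow-up in the class
(equivariant KNSS/Seregin–Šverák zoom about the apex) and redire -/
@[route_item "route-NavierStokesRegularity-MirrorChamber"]
def OctahedralLiouville : Prop :=
  ∀ u : ℝ → EuclideanSpace ℝ (Fin 3) → EuclideanSpace ℝ (Fin 3), Literature.Analysis.FluidPDE.IsAncientMildSolution 1 u → (∀ t < 0, AEStronglyMeasurable (u t) volume) → (∀ t < 0, ∀ (σ : Equiv.Perm (Fin 3)) (ε : Fin 3 → ℝ), (∀ i, ε i = 1 ∨ ε i = -1) → ∀ x : EuclideanSpace ℝ (Fin 3), u t (WithLp.toLp 2 fun i => ε i * x (σ i)) = WithLp.toLp 2 fun i => ε i * u t x (σ i)) → (∃ C₀ : ℝ, Literature.Analysis.FluidPDE.HasTypeIDecay C₀ u) → ∀ t < 0, u t =ᵐ[volume] 0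

/-- item stmt-NavierStokesRegularity-17632 · support · rank 9 · closed · proved by Summit.NavierStokesRegularity.NavierStokesRegularity.Theorems.mirrorChamber_chamberBlowupOfProfile_proof (prover) · by planner
sources: BealeKatoMajda1984, CaffarelliKohnNirenberg1982
[support] GLUE of the crux-strategist decomposition of the deciding crux ChamberBlowup (BC2 redirect
2026-08-17; `route edit --split` is final-cycle-only, so the decomposition is filed flat, as on
routes SubcubicESS / SqueezeCycle): ChamberDssProfile → EquivariantTruncation → ChamberBlowup, BY
ITEM NAME. PROVABLE NOW — in fact PROVED: theorem chamberBlowup_of_profile_truncation in the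
strategist's workfile Cruxes/ChamberBlowup/Split.lean (commit 283a2e8ff2e8; lean rc0, 0 sorry,
axioms propext/Classical.choice/Quot.sound; evidence on stmt-NavierStokesRegularity-1597), with
EquivariantTruncation inlined verbatim, so this item is closed by `fun h₁ h₂ =>
chamberBlowup_of_profile_truncation h₁ h₂` once a prover lands that file as
Theorems/MirrorChamberChamberBlowupSplit.lean. Proof (≈30 lines, not a one-line seam): take the
profile (c, U) from ChamberDssProfile; EquivariantTruncation realises it as a classical solution
(u,p), ν = 1, on Ico 0 T, Leray–Hopf from its rapidly decaying datum, B₃-equivariant, bounded by M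
on {‖x‖ ≥ R}×[0,T) and unbounded on [0,T)×ℝ³; a classical extension u' on Ico 0 T'' (T'' > T) would
be jointly smooth, hence continuous, hence bounded by some M₁ on the COMP -/
@[route_item "route-NavierStokesRegularity-MirrorChamber"]
def ChamberBlowupOfProfile : Prop :=
  Summit.NavierStokesRegularity.NavierStokesRegularity.Theses.MirrorChamber.ChamberDssProfile → Summit.NavierStokesRegularity.NavierStokesRegularity.Theses.MirrorChamber.EquivariantTruncation → Summit.NavierStokesRegularity.NavierStokesRegularity.Theses.MirrorChamber.ChamberBlowup

-- `ChamberBlowupOfProfile` holds: proved by `Summit.NavierStokesRegularity.NavierStokesRegularity.Theorems.mirrorChamber_chamberBlowupOfProfile_proof` (its module imports this route file, so no `_holds` link can be stated here).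

/-- item stmt-NavierStokesRegularity-1604 · assembly · rank 1 · closed · proved by Summit.NavierStokesRegularity.NavierStokesRegularity.Theorems.mirrorChamber_assembly_proof (prover) · by planner
sources: Fefferman2000, BealeKatoMajda1984
[assembly] ChamberBlowup → X5b → ¬NavierStokesRegularity: forget the symmetry clause of
ChamberBlowup and apply the PROVED glue Literature.NS.blowup_assembly
(stmt-NavierStokesRegularity-0151, Theorems/BlowupAssembly.lean). Three lines; checked in the
planner's Sketch.lean (theorem assembly_holds). [sources: Fefferman2000, BealeKatoMajda1984] -/
@[route_item "route-NavierStokesRegularity-MirrorChamber"]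
def Assembly : Prop :=
  (∃ ν : ℝ, 0 < ν ∧ ∃ T : ℝ, 0 < T ∧ ∃ (u : ℝ → EuclideanSpace ℝ (Fin 3) → EuclideanSpace ℝ (Fin 3)) (p : ℝ → EuclideanSpace ℝ (Fin 3) → ℝ), Literature.Analysis.FluidPDE.IsMaximalSmoothSolution ν 0 u p T ∧ Literature.Analysis.FluidPDE.IsLerayHopfOn T ν 0 (u 0) u ∧ Literature.Analysis.FluidPDE.HasRapidSpatialDecay (u 0) ∧ ∀ t ∈ Set.Ico 0 T, ∀ (σ : Equiv.Perm (Fin 3)) (ε : Fin 3 → ℝ), (∀ i, ε i = 1 ∨ ε i = -1) → ∀ x : EuclideanSpace ℝ (Fin 3), u t (WithLp.toLp 2 fun i => ε i * x (σ i)) = WithLp.toLp 2 fun i => ε i * u t x (σ i)) → (∀ ν : ℝ, 0 < ν → ∀ (u₀ : EuclideanSpace ℝ (Fin 3) → EuclideanSpace ℝ (Fin 3)), Literature.Analysis.FluidPDE.HasRapidSpatialDecay u₀ → ∀ (u v : ℝ → EuclideanSpace ℝ (Fin 3) → EuclideanSpace ℝ (Fin 3)) (p q : ℝ → EuclideanSpace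 ℝ (Fin 3) → ℝ) (T : ℝ), 0 < T → Literature.Analysis.FluidPDE.IsSmoothOnHalfSpace u → Literature.Analysis.FluidPDE.IsSmoothOnHalfSpace p → Literature.Analysis.FluidPDE.IsNavierStokesSolution ν 0 u₀ u p → Literature.Analysis.FluidPDE.HasBoundedEnergy u → Literature.Analysis.FluidPDE.IsClassicalNSSolutionOn (Set.Ico 0 T) ν 0 v q → Literature.Analysis.FluidPDE.IsLerayHopfOn T ν 0 u₀ v → v 0 = u₀ → ∀ t ∈ Set.Ico 0 T, u t = v t) → ¬ NavierStokesRegularity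

-- `Assembly` holds: proved by `Summit.NavierStokesRegularity.NavierStokesRegularity.Theorems.mirrorChamber_assembly_proof` (its module imports this route file, so no `_holds` link can be stated here).

/-! D-0027 §2.1 — DECIDING THEOREM (planner-authored via `route open/edit --closes-file`; by planner-rbadge-NavierStokesRegularity-MirrorCh-de5cbd29-g2-0 2026-08-15T16:11:54Z):
its hypotheses are this route's items and its conclusion the sub-problem Statement (glue_lint), and it elaborates with this file. -/

/-- DECIDING THEOREM (D-0027 §2.1), refutation side: the rank-2 crux `ChamberBlowup` (X5a inside
the hyperoctahedral class B₃) together with the shared support `ClayUniqueness` (X5b,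
stmt-NavierStokesRegularity-0153) refutes Clay (A). Pure logic — forget the B₃-equivariance clause
and run the argument of the proved glue `Literature.NS.blowup_assembly`
(Theorems/BlowupAssembly.lean, stmt-NavierStokesRegularity-0151) inline: (A) applied to the datum
`u 0` (smooth and divergence free as a slice of a classical solution, rapidly decaying by
hypothesis) gives a global Clay-class solution `(u', p')`; `ClayUniqueness` identifies `u'` with
`u` on `[0, T)`; `(u', p')` is a classical solution on `Ici 0` (the wave-0 bridge, field for
field), and its restriction to `Ico 0 (T + 1)` is a smooth extension of `u` past `T`,
contradicting maximality (Beale–Kato–Majda 1984, §1). The other items (ChamberDssProfile,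
ChamberEulerBlowup, ApexJet, MirrorVorticityLaw, OctahedralLiouville, ProfileNegatesWall) feed
`ChamberBlowup` in layer 2 and are deliberately not hypotheses here. -/
@[closes "route-NavierStokesRegularity-MirrorChamber"] theorem closes (hX : ChamberBlowup) (hU : ClayUniqueness) : ¬ _root_.NavierStokesRegularity := by
  rintro hA
  obtain ⟨ν, hν, T, hT, u, p, ⟨hcl, hmax⟩, hLH, hdec, -⟩ := hX
  have h0 : (0 : ℝ) ∈ Set.Ico 0 T := ⟨le_rfl, hT⟩
  obtain ⟨u', p', hu', hp', hns, hbe⟩ :=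
    hA ν hν (u 0) (hcl.contDiff_velocity h0) (hcl.divFree 0 h0) hdec
  have heq : ∀ t ∈ Set.Ico 0 T, u' t = u t :=
    hU ν hν (u 0) hdec u' u p' p T hT hu' hp' hns hbe hcl hLH rfl
  have hcl' : Literature.Analysis.FluidPDE.IsClassicalNSSolutionOn (Set.Ici 0) ν 0 u' p' :=
    ⟨hu', hp', fun t ht x => hns.momentum t ht x, fun t ht => hns.divFree t ht⟩
  refine hmax ⟨T + 1, by linarith, u', p', ?_, heq⟩
  exact hcl'.mono (fun t ht => ht.1) (uniqueDiffOn_Ico 0 (T + 1))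

end Summit.NavierStokesRegularity.NavierStokesRegularity.Theses.MirrorChamber
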